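import Summits.BirchSwinnertonDyer.BirchSwinnertonDyer.Theorems.PrintCFramBottomClassIndexLawFiveLeEisensteinResidualCounts
import Summits.BirchSwinnertonDyer.BirchSwinnertonDyer.Theorems.UniversalToricDescentAcDualMuZeroCriterion
import Summits.BirchSwinnertonDyer.BirchSwinnertonDyer.Theorems.UniversalToricDescentResidualSelmerExact
import Summits.BirchSwinnertonDyer.BirchSwinnertonDyer.Theorems.ResidualThetaTransportAtTwoLambdaLeCardQuotient
import Literature.NumberTheory.EllipticCurves.IwasawaAlgebraProofs
import HarnessLib

/-!
# Route `PrintCFram`, crux C2 `BottomClassIndexLawFiveLe` (stmt-BirchSwinnertonDyer-20372), line `eisenstein-resource-bdp-line`: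
# the λ-INVARIANT of Castella's Selmer dual is bounded by the two CHARACTER residual Selmer groups —
# `p^{λ(X_(∅,0)(E/K_∞))} ≤ #R_𝔭(K_∞, Φ) · #R_𝔭(K_∞, E[p]/Φ)` (CGLS Thm. 3.2.1, λ-part, as an INEQUALITY, reduction-type-free)
# (cell `bsd-print-cfram`, width seat `bsd-line-cfram-p1-w2` g3; helper `--supports` 20372; THEOREMS ONLY, 0 facts, 0 definitions)

HONEST FRAMING. Nothing about BSD is proved; no stub is closed. GENERIC statements (any elliptic curve over a number field, any odd
`p`, any `ℤ_p`-extension, any strict place `𝔭 ∋ p` finitely decomposed, any `Γ_K`-stable line `Φ ≤ E[p]`), assembled from landed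
theorems: `p^{λ(X)} ≤ #(X/pX)` (RTT `LambdaLowerBound.pow_lambdaInvariant_le_natCard_quotient`), `#(X/(p)X) ≤ #Sel[p]` and the counted
devissage (this seat's `…EisensteinResidualCounts`), `#R(E[p]) = #Sel[p]` under (L) «`E[p^∞]^{G_{K_{∞,𝔭}}}` has no `p`-torsion»
(UTD `natCard_residualSelmer_eq_natCard_selmerAc_pTorsion`), torsion/`μ = 0`/`ℤ_p`-finiteness from `Sel[p]` finite (UTD), imprimitivity
`Sel^∅ ≤ Sel^Σ` (CHL).

* `pow_lambdaInvariant_le_natCard_selmerAc_pTorsion` — `p^{λ(X_ac^Σ)} ≤ #Sel_𝔭^Σ(K_∞, E[p^∞])[p]` whenever the right side is finite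
  (finite `Σ`).
* `pow_lambdaInvariant_le_mul_natCard_residualSelmer_of_line` — `p^{λ(X_ac^Σ)} ≤ #R^Σ(Φ) · #R^Σ(E[p]/Φ)` from the line-devissage data
  (CHL shape) + (L).
* `pow_lambdaInvariant_empty_le_mul_natCard_residualSelmer_of_line` — the same for the `Σ`-PRIMITIVE dual `X_(∅,0) = X_ac^∅` of the
  registered stubs (`Σ` any set containing the bad places prime to `p`, e.g. those places).

MEANING for stub 2′ (`stub_invariantMatch_cmRamified`): with (AN) ⟸ (AN-cong) ∧ (AN-λ) (`…EisensteinAnalyticSplit`) and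
`λ(X_(∅,0)) ≤ log_p #R(Φ) + log_p #R(E[p]/Φ)` (this file, kernel), the λ-half (AN-λ) is implied by the two CHARACTER-LEVEL residual
inequalities «`log_p #R_𝔭′(K''_∞, 𝔽_p(χ)) ≤ ord L̄_χ`» for `χ = χ_d ω^{(p+1)/4}`, `χ_d ω^{(3p−1)/4}` — the quantitative form of CGLS Prop. 14
(Rubin's divisibility + Hida `μ = 0`, with «no finite submodule» for the character modules); no elliptic-curve Iwasawa theory is left
in stub 2′ except the Λ-adic congruence (AN-cong). BSD is not proved by any of this; no summit statement is proved by this seat.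

References: Castella–Grossi–Lee–Skinner 2022 §3 Thm. 3.2.1, Props. 14, 17, 18 [CastellaGrossiLeeSkinner2022]; Greenberg–Vatsal 2000 §2
Prop. (2.8) [GreenbergVatsal2000]; Greenberg LNM 1716 §1 [GreenbergLNM1716]; Washington §13.2 [Washington1997]; Matsuno 2008 Lemma 4.3
[Matsuno2008].
-/

set_option autoImplicit false
-- the summit namespace `Summit.BirchSwinnertonDyer.BirchSwinnertonDyer` repeats the problem name by design (D-0017)
set_option linter.dupNamespace false

noncomputable section

open scoped Classical

namespace Summit.BirchSwinnertonDyer.BirchSwinnertonDyer.Theorems.PrintCFram.LambdaResidualBound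

open NumberField IsDedekindDomain Field
  Literature.NumberTheory.EllipticCurves Literature.NumberTheory.EllipticCurves.GreenbergSelmer
  Literature.NumberTheory.EllipticCurves.GreenbergVatsal2000
  Literature.NumberTheory.EllipticCurves.IwasawaAlgebra
  Literature.NumberTheory.GaloisRepresentations
  Summit.BirchSwinnertonDyer.Rank1Residual.X11b Summit.BirchSwinnertonDyer.Rank1Residual.X11b.AcSelmer
  Summit.BirchSwinnertonDyer.Rank1Residual.X2.ResidualDevissageModules
  Summit.BirchSwinnertonDyer.BirchSwinnertonDyer.Theorems.UniversalToricDescentAcDualMuZero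
  Summit.BirchSwinnertonDyer.BirchSwinnertonDyer.Theorems.UniversalToricDescentResidualSelmerExact
  Summit.BirchSwinnertonDyer.BirchSwinnertonDyer.Theorems.CumulativeHeegnerInclusionAtThreeResidualDevissage
  Summit.BirchSwinnertonDyer.BirchSwinnertonDyer.Theorems.PrintCFram.ResidualCounts

universe u

variable {K : Type} [Field K] [NumberField K] (W : WeierstrassCurve K) [W.IsElliptic] (p : ℕ) [hp : Fact p.Prime]
  (κ : ZpExtension K p) (𝔭 : HeightOneSpectrum (𝓞 K)) (γ : absoluteGaloisGroup K) [Fact (κ.IsTopGenerator γ)]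

/-! ## §1 `p^{λ(X)} ≤ #Sel[p]` -/

/-- The `ℤ_p`-submodule `pX` and the `Λ`-submodule `(p)·X = C(p)·X` of a `Λ`-module have the same underlying subgroup
(`ℤ_p` acting through `ℤ_p → Λ`). [folklore] -/
theorem toAddSubgroup_pSmul_eq (X : Type*) [AddCommGroup X] [Module (IwasawaAlgebra p) X] :
    letI : Module ℤ_[p] X := Module.compHom X (algebraMap ℤ_[p] (IwasawaAlgebra p))
    (Ideal.span {(p : ℤ_[p])} • ⊤ : Submodule ℤ_[p] X).toAddSubgroup =
      (Ideal.span {PowerSeries.C (p : ℤ_[p])} • ⊤ : Submodule (IwasawaAlgebra p) X).toAddSubgroup := by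
  letI : Module ℤ_[p] X := Module.compHom X (algebraMap ℤ_[p] (IwasawaAlgebra p))
  have hsm : ∀ n : X, (p : ℤ_[p]) • n = (PowerSeries.C (p : ℤ_[p]) : IwasawaAlgebra p) • n := fun n ↦ by
    change (algebraMap ℤ_[p] (IwasawaAlgebra p) (p : ℤ_[p])) • n = _
    rw [map_natCast, map_natCast]
  ext x
  simp only [Submodule.mem_toAddSubgroup, Submodule.ideal_span_singleton_smul, Submodule.mem_smul_pointwise_iff_exists,
    Submodule.mem_top, true_and, hsm]

/-- **`p^{λ(X_ac^Σ)} ≤ #Sel_𝔭^Σ(K_∞, E[p^∞])[p]`** (finite `Σ`) whenever the right-hand side is finite: then `X` is torsion with `μ = 0`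
and finitely generated over `ℤ_p` (UTD), `p^{λ(X)} ≤ #(X/pX)` (RTT), and `#(X/(p)X) ≤ #Sel[p]` (exactness of Pontryagin duality at `p`,
counted). [cite: GreenbergVatsal2000, §2 Prop. (2.8)] [cite: Washington1997, §13.2] -/
theorem pow_lambdaInvariant_le_natCard_selmerAc_pTorsion {S : Set (HeightOneSpectrum (𝓞 K))} (hS : S.Finite)
    (hfin : Set.Finite {s : selmerAc W p κ 𝔭 S | p • s = 0}) :
    p ^ lambdaInvariant p (XAc W p κ 𝔭 S γ) ≤ Nat.card {s : selmerAc W p κ 𝔭 S // p • s = 0} := by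
  haveI := XAc.module_finite κ 𝔭 S γ hS (W := W)
  have htor := isTorsion_of_finite_pTorsion W p κ 𝔭 S γ hS hfin
  have hμ := muInvariant_eq_zero_of_finite_pTorsion W p κ 𝔭 S γ hS hfin
  letI : Module ℤ_[p] (XAc W p κ 𝔭 S γ) := Module.compHom (XAc W p κ 𝔭 S γ) (algebraMap ℤ_[p] (IwasawaAlgebra p))
  haveI : IsScalarTower ℤ_[p] (IwasawaAlgebra p) (XAc W p κ 𝔭 S γ) := IsScalarTower.of_compHom _ _ _
  haveI : Module.Finite ℤ_[p] (XAc W p κ 𝔭 S γ) := (muInvariant_eq_zero_iff_finite p (XAc W p κ 𝔭 S γ) htor).mp hμ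
  have h1 := LambdaLowerBound.pow_lambdaInvariant_le_natCard_quotient p (XAc W p κ 𝔭 S γ)
  have h2 : Nat.card (XAc W p κ 𝔭 S γ ⧸ (Ideal.span {(p : ℤ_[p])} • ⊤ : Submodule ℤ_[p] (XAc W p κ 𝔭 S γ))) =
      Nat.card (XAc W p κ 𝔭 S γ ⧸
        (Ideal.span {PowerSeries.C (p : ℤ_[p])} • ⊤ : Submodule (IwasawaAlgebra p) (XAc W p κ 𝔭 S γ))) := by
    change Nat.card (XAc W p κ 𝔭 S γ ⧸ (Ideal.span {(p : ℤ_[p])} • ⊤ : Submodule ℤ_[p] (XAc W p κ 𝔭 S γ)).toAddSubgroup) =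
      Nat.card (XAc W p κ 𝔭 S γ ⧸
        (Ideal.span {PowerSeries.C (p : ℤ_[p])} • ⊤ : Submodule (IwasawaAlgebra p) (XAc W p κ 𝔭 S γ)).toAddSubgroup)
    rw [toAddSubgroup_pSmul_eq p (XAc W p κ 𝔭 S γ)]
  have h3 := IwasawaDualCount.natCard_quotient_pSmul_le_natCard_pTorsion (XAc.isDualPair W p κ 𝔭 S γ).bijective
    (XAc.isDualPair W p κ 𝔭 S γ).C_smul (selmerAc_exists_pow_smul_eq_zero W p κ 𝔭 S) hfin
  calc p ^ lambdaInvariant p (XAc W p κ 𝔭 S γ)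
      ≤ Nat.card (XAc W p κ 𝔭 S γ ⧸ (Ideal.span {(p : ℤ_[p])} • ⊤ : Submodule ℤ_[p] (XAc W p κ 𝔭 S γ))) := h1
    _ = _ := h2
    _ ≤ Nat.card {s : selmerAc W p κ 𝔭 S // p • s = 0} := h3

/-! ## §2 `p^{λ}` bounded by the product of the two residual Selmer groups of the line devissage -/

/-- **`p^{λ(X_ac^Σ(E[p^∞]))} ≤ #R_𝔭^Σ(K_∞, Φ) · #R_𝔭^Σ(K_∞, E[p]/Φ)`** (CGLS Thm. 3.2.1's λ-comparison as an INEQUALITY, for any reduction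
type). Hypotheses: `p` odd; `Σ` finite containing the bad places prime to `p`; `𝔭 ∋ p` with `D_𝔭 ⊄ ker κ`; a `Γ_K`-stable `Φ ≤ E[p]` with no
non-zero `G_{K_{∞,𝔭}}`-fixed vector in `E[p]/Φ`; (L) `E[p^∞]^{G_{K_{∞,𝔭}}}` has no `p`-torsion; the two residual Selmer groups finite.
Proof: §1, `#Sel[p] = #R(E[p])` under (L), and the counted devissage. [cite: CastellaGrossiLeeSkinner2022, §3 Thm. 3.2.1 and Props. 17–18 (arXiv:2008.02571)]
[cite: GreenbergVatsal2000, §2 Prop. (2.8)] -/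
theorem pow_lambdaInvariant_le_mul_natCard_residualSelmer_of_line (hp2 : p ≠ 2)
    (h𝔭 : ((p : ℕ) : 𝓞 K) ∈ 𝔭.asIdeal) (h𝔭dec : ¬ (decomp 𝔭 ≤ κ.kerSubgroup))
    {S : Set (HeightOneSpectrum (𝓞 K))} (hS : S.Finite)
    (hSgood : ∀ v : HeightOneSpectrum (𝓞 K), v ∉ S → ((p : ℕ) : 𝓞 K) ∉ v.asIdeal → W.HasGoodReductionAt v)
    (Φ : StableSubgroup (absoluteGaloisGroup K) (W.geomTorsion (p : ℤ)))
    (hfix : ∀ y : Φ.Quot, (∀ g : ↥(κ.kerSubgroup ⊓ decomp 𝔭), g • y = y) → y = 0)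
    (hL : ∀ m : W.geomPrimaryTorsion p, (∀ σ ∈ κ.kerSubgroup ⊓ decomp 𝔭, σ • m = m) → p • m = 0 → m = 0)
    (hΦ : (datumStrictSelmer κ.kerSubgroup Φ.Sub p (AcSelmer.bdpData Φ.Sub p 𝔭) S :
      Set (subgroupH1 κ.kerSubgroup Φ.Sub)).Finite)
    (hΨ : (datumStrictSelmer κ.kerSubgroup Φ.Quot p (AcSelmer.bdpData Φ.Quot p 𝔭) S :
      Set (subgroupH1 κ.kerSubgroup Φ.Quot)).Finite) :
    p ^ lambdaInvariant p (XAc W p κ 𝔭 S γ) ≤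
      Nat.card (datumStrictSelmer κ.kerSubgroup Φ.Sub p (AcSelmer.bdpData Φ.Sub p 𝔭) S) *
        Nat.card (datumStrictSelmer κ.kerSubgroup Φ.Quot p (AcSelmer.bdpData Φ.Quot p 𝔭) S) := by
  have hfin := finite_selmerAc_pTorsion_of_line_devissage W κ h𝔭 h𝔭dec hSgood Φ hfix hΦ hΨ
  have h1 := pow_lambdaInvariant_le_natCard_selmerAc_pTorsion W p κ 𝔭 γ hS hfin
  have h2 := natCard_residualSelmer_eq_natCard_selmerAc_pTorsion W κ hp2 h𝔭 hSgood hL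
  have hunr' : ∀ v : HeightOneSpectrum (𝓞 K), v ∉ S → ((p : ℕ) : 𝓞 K) ∉ v.asIdeal →
      ∀ x ∈ inertia v, ∀ m : W.geomTorsion (p : ℤ), x • m = m :=
    fun v hvS hpv _ hx m ↦ smul_geomTorsion_eq_of_mem_inertia_chosen W (hSgood v hvS hpv) hpv hx m
  have h3 := natCard_residualSelmer_le_mul_of_stableSubgroup κ.kerSubgroup p 𝔭 S Φ
    (continuous_smul_geomTorsion W (p : ℤ)) hunr' hfix hΦ hΨ
  rw [← h2] at h1
  exact h1.trans h3

/-- **The `Σ`-PRIMITIVE form: `p^{λ(X_(∅,0)(E/K_∞))} ≤ #R_𝔭^Σ(K_∞, Φ) · #R_𝔭^Σ(K_∞, E[p]/Φ)`** for the dual `X_(∅,0) = X_ac^∅` of the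
registered stubs of C2 (strict at `𝔭`, no auxiliary places), `Σ` ANY set containing the bad places prime to `p` (finite or not):
`Sel^∅ ≤ Sel^Σ` (`selmerAc_empty_le`), so `#Sel^∅[p] ≤ #Sel^Σ[p] = #R^Σ(E[p]) ≤ #R^Σ(Φ)·#R^Σ(E[p]/Φ)`, and §1 at `Σ = ∅`.
[cite: CastellaGrossiLeeSkinner2022, §3 Thm. 3.2.1 and Props. 17–18 (arXiv:2008.02571)] [cite: GreenbergVatsal2000, §2 Prop. (2.8)] -/
theorem pow_lambdaInvariant_empty_le_mul_natCard_residualSelmer_of_line (hp2 : p ≠ 2)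
    (h𝔭 : ((p : ℕ) : 𝓞 K) ∈ 𝔭.asIdeal) (h𝔭dec : ¬ (decomp 𝔭 ≤ κ.kerSubgroup))
    {S : Set (HeightOneSpectrum (𝓞 K))}
    (hSgood : ∀ v : HeightOneSpectrum (𝓞 K), v ∉ S → ((p : ℕ) : 𝓞 K) ∉ v.asIdeal → W.HasGoodReductionAt v)
    (Φ : StableSubgroup (absoluteGaloisGroup K) (W.geomTorsion (p : ℤ)))
    (hfix : ∀ y : Φ.Quot, (∀ g : ↥(κ.kerSubgroup ⊓ decomp 𝔭), g • y = y) → y = 0)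
    (hL : ∀ m : W.geomPrimaryTorsion p, (∀ σ ∈ κ.kerSubgroup ⊓ decomp 𝔭, σ • m = m) → p • m = 0 → m = 0)
    (hΦ : (datumStrictSelmer κ.kerSubgroup Φ.Sub p (AcSelmer.bdpData Φ.Sub p 𝔭) S :
      Set (subgroupH1 κ.kerSubgroup Φ.Sub)).Finite)
    (hΨ : (datumStrictSelmer κ.kerSubgroup Φ.Quot p (AcSelmer.bdpData Φ.Quot p 𝔭) S :
      Set (subgroupH1 κ.kerSubgroup Φ.Quot)).Finite) :
    p ^ lambdaInvariant p (XAc W p κ 𝔭 ∅ γ) ≤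
      Nat.card (datumStrictSelmer κ.kerSubgroup Φ.Sub p (AcSelmer.bdpData Φ.Sub p 𝔭) S) *
        Nat.card (datumStrictSelmer κ.kerSubgroup Φ.Quot p (AcSelmer.bdpData Φ.Quot p 𝔭) S) := by
  have hfinS := finite_selmerAc_pTorsion_of_line_devissage W κ h𝔭 h𝔭dec hSgood Φ hfix hΦ hΨ
  have hfin0 := finite_selmerAc_empty_pTorsion_of_line_devissage W κ h𝔭 h𝔭dec hSgood Φ hfix hΦ hΨ
  have h1 := pow_lambdaInvariant_le_natCard_selmerAc_pTorsion W p κ 𝔭 γ Set.finite_empty hfin0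
  -- `#Sel^∅[p] ≤ #Sel^Σ[p]`
  haveI : Finite {s : selmerAc W p κ 𝔭 S // p • s = 0} := hfinS.to_subtype
  let g : ↥(selmerAc W p κ 𝔭 ∅) →+ ↥(selmerAc W p κ 𝔭 S) := AddSubgroup.inclusion selmerAc_empty_le
  have hg : Function.Injective g := AddSubgroup.inclusion_injective selmerAc_empty_le
  have h2 : Nat.card {s : selmerAc W p κ 𝔭 ∅ // p • s = 0} ≤ Nat.card {s : selmerAc W p κ 𝔭 S // p • s = 0} := by
    refine Nat.card_le_card_of_injective (fun s ↦ ⟨g s.1, ?_⟩) fun a b h ↦ ?_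
    · show p • g s.1 = 0
      rw [← map_nsmul, s.2, map_zero]
    · exact Subtype.ext (hg (congrArg Subtype.val h))
  have h3 := natCard_residualSelmer_eq_natCard_selmerAc_pTorsion W κ hp2 h𝔭 hSgood hL
  have hunr' : ∀ v : HeightOneSpectrum (𝓞 K), v ∉ S → ((p : ℕ) : 𝓞 K) ∉ v.asIdeal →
      ∀ x ∈ inertia v, ∀ m : W.geomTorsion (p : ℤ), x • m = m :=
    fun v hvS hpv _ hx m ↦ smul_geomTorsion_eq_of_mem_inertia_chosen W (hSgood v hvS hpv) hpv hx m
  have h4 := natCard_residualSelmer_le_mul_of_stableSubgroup κ.kerSubgroup p 𝔭 S Φ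
    (continuous_smul_geomTorsion W (p : ℤ)) hunr' hfix hΦ hΨ
  calc p ^ lambdaInvariant p (XAc W p κ 𝔭 ∅ γ) ≤ Nat.card {s : selmerAc W p κ 𝔭 ∅ // p • s = 0} := h1
    _ ≤ Nat.card {s : selmerAc W p κ 𝔭 S // p • s = 0} := h2
    _ = _ := h3.symm
    _ ≤ _ := h4

end Summit.BirchSwinnertonDyer.BirchSwinnertonDyer.Theorems.PrintCFram.LambdaResidualBound

end
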